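import Summits.CriticalPhenomena.PercolationContinuityZ3.Theorems.FK.DomainMarkovExtremality
import Summits.CriticalPhenomena.PercolationContinuityZ3.Theorems.FK.InfiniteVolumeMeasures
import HarnessLib

/-!
# FK-continuity transplant, FO-10 (domain-Markov toolkit, seat A): extremality of THE infinite-volume measures
# `φ⁰_{p,q} = rcLimit d false p q` and `φ¹_{p,q} = rcLimit d true p q` within the sandwich class `FKGibbs`

Cell `fk-continuity` (bschramm), row FO-10a; support file for the FK-continuity transplant
(`--supports stmt-CriticalPhenomena-4575`); builds on p205010 (kernel theorem, internal audit signed; external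
expert review pending).  Pure proofs; no definitions, no named facts, no sorries.  The abstract extremality
theorems of `DomainMarkovToolkit.lean` / `DomainMarkovExtremality.lean` (stated for any `P₀, P₁` with
`IsBoxLimit d false/true p q P_b`, and with the lattice-support hypothesis `∀ᵐ ω ∂P_b, ω ⊆ E(ℤ^d)` where needed)
specialised to the named limits of FO-06b's `InfiniteVolumeMeasures.lean` (`isBoxLimit_rcLimit`,
`IsBoxLimit.ae_subset_edgeSet`; `p ∈ [0,1]`, `q ≥ 1`), so that consumers can cite Grimmett's (4.21)/(4.35)/(4.36)
with the measures by name.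

## Contents (all for `hP : FKGibbs d p q P`, `p ∈ [0,1]`, `q ≥ 1`)

* `FKGibbs.rcLimit_false_real_le` / `FKGibbs.real_le_rcLimit_true` — `φ⁰_{p,q}(A) ≤ P(A) ≤ φ¹_{p,q}(A)` for
  increasing events determined by the edges `E_Λ` of a finite region; `…_of_determinedBy_sym2` forms for events
  determined by all pairs of a region (open-path events); decreasing twins; the one-arm events
  `FKGibbs.rcLimit_false_real_siteToBoundary_le` / `FKGibbs.real_siteToBoundary_le_rcLimit_true`
  (`φ⁰_{p,q}(0 ↔ ∂Λ_n) ≤ P(0 ↔ ∂Λ_n) ≤ φ¹_{p,q}(0 ↔ ∂Λ_n)`).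
* `FKGibbs.eq_rcLimit_of_rcLimit_false_eq_true` — (4.36) "⇐": if `φ⁰_{p,q} = φ¹_{p,q}` then every `P` of the
  sandwich class equals it; `FKGibbs.eq_of_rcLimit_false_eq_true` — hence any two members coincide.

(The `θ`-level reading `θ⁰(p,q) ≤ P(0 ↔ ∞) ≤ θ¹(p,q)` is the composition of the one-arm inequalities with FO-07's
`IsBoxLimit.real_percolatesAt_eq_thetaFree/Wired` and FO-03b′'s `FK.real_percolatesAt_eq_iInf_real_siteToBoundary`;
it is typed by its consumer FO-11.)

## References

* G. Grimmett, *The Random-Cluster Model*, Springer 2006: Thm. (4.19)(c) eq. (4.21) p. 76, Thm. (4.34)(b)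
  eqs. (4.35)–(4.36) p. 81. [Grimmett2006]
-/

noncomputable section

open MeasureTheory Set Filter
open scoped Topology ENNReal

namespace Summit.CriticalPhenomena.PercolationContinuityZ3.Theorems.FK

open Literature.Probability.Percolation Literature.Probability.LatticeModels

namespace FKGibbs

variable {d : ℕ} {p q : ℝ} {P P' : Measure (BondConfig (Site d))}

/-! ### `φ⁰_{p,q} ≤ P ≤ φ¹_{p,q}` on increasing local events -/

/-- **`φ⁰_{p,q}(A) ≤ P(A)`** for every `P` of the sandwich class and every increasing event `A` determined by the
edges of a finite region (Grimmett 2006, (4.21)/(4.35) with the free limit by name). [cite: Grimmett2006, Thm. (4.19)(c) eq. (4.21)] -/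
theorem rcLimit_false_real_le (hP : FKGibbs d p q P) (hp : p ∈ Set.Icc (0 : ℝ) 1) (hq : 1 ≤ q)
    {A : Set (BondConfig (Site d))} {Λ : Finset (Site d)} (hA : IsUpperSet A)
    (hAΛ : DeterminedBy A ↑(edgesIn (zdGraph d) Λ)) : (rcLimit d false p q).real A ≤ P.real A :=
  hP.isBoxLimit_real_le (isBoxLimit_rcLimit false hp hq) hA hAΛ

/-- **`P(A) ≤ φ¹_{p,q}(A)`** for every `P` of the sandwich class and every increasing event `A` determined by the
edges of a finite region. [cite: Grimmett2006, Thm. (4.19)(c) eq. (4.21)] -/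
theorem real_le_rcLimit_true (hP : FKGibbs d p q P) (hp : p ∈ Set.Icc (0 : ℝ) 1) (hq : 1 ≤ q)
    {A : Set (BondConfig (Site d))} {Λ : Finset (Site d)} (hA : IsUpperSet A)
    (hAΛ : DeterminedBy A ↑(edgesIn (zdGraph d) Λ)) : P.real A ≤ (rcLimit d true p q).real A :=
  hP.real_le_isBoxLimit (isBoxLimit_rcLimit true hp hq) hA hAΛ

/-- `φ⁰_{p,q}(A) ≤ P(A)` for an increasing event determined by ALL PAIRS of a finite region (open-path events).
[cite: Grimmett2006, Thm. (4.19)(c) eq. (4.21)] -/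
theorem rcLimit_false_real_le_of_determinedBy_sym2 (hP : FKGibbs d p q P) (hp : p ∈ Set.Icc (0 : ℝ) 1)
    (hq : 1 ≤ q) {A : Set (BondConfig (Site d))} {Λ : Finset (Site d)} (hA : IsUpperSet A)
    (hAΛ : DeterminedBy A ↑(Λ.sym2)) : (rcLimit d false p q).real A ≤ P.real A :=
  hP.isBoxLimit_real_le_of_determinedBy_sym2 (isBoxLimit_rcLimit false hp hq)
    ((isBoxLimit_rcLimit false hp hq).ae_subset_edgeSet hp (one_pos.trans_le hq)) hA hAΛ

/-- `P(A) ≤ φ¹_{p,q}(A)` for an increasing event determined by all pairs of a finite region.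
[cite: Grimmett2006, Thm. (4.19)(c) eq. (4.21)] -/
theorem real_le_rcLimit_true_of_determinedBy_sym2 (hP : FKGibbs d p q P) (hp : p ∈ Set.Icc (0 : ℝ) 1)
    (hq : 1 ≤ q) {A : Set (BondConfig (Site d))} {Λ : Finset (Site d)} (hA : IsUpperSet A)
    (hAΛ : DeterminedBy A ↑(Λ.sym2)) : P.real A ≤ (rcLimit d true p q).real A :=
  hP.real_le_isBoxLimit_of_determinedBy_sym2 (isBoxLimit_rcLimit true hp hq)
    ((isBoxLimit_rcLimit true hp hq).ae_subset_edgeSet hp (one_pos.trans_le hq)) hA hAΛ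

/-- Decreasing local events: `P(D) ≤ φ⁰_{p,q}(D)`. [cite: Grimmett2006, Thm. (4.19)(c) eq. (4.21)] -/
theorem real_le_rcLimit_false_of_isLowerSet (hP : FKGibbs d p q P) (hp : p ∈ Set.Icc (0 : ℝ) 1) (hq : 1 ≤ q)
    {D : Set (BondConfig (Site d))} {Λ : Finset (Site d)} (hD : IsLowerSet D)
    (hDΛ : DeterminedBy D ↑(edgesIn (zdGraph d) Λ)) : P.real D ≤ (rcLimit d false p q).real D :=
  hP.real_le_isBoxLimit_of_isLowerSet (isBoxLimit_rcLimit false hp hq) hD hDΛ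

/-- Decreasing local events: `φ¹_{p,q}(D) ≤ P(D)`. [cite: Grimmett2006, Thm. (4.19)(c) eq. (4.21)] -/
theorem rcLimit_true_real_le_of_isLowerSet (hP : FKGibbs d p q P) (hp : p ∈ Set.Icc (0 : ℝ) 1) (hq : 1 ≤ q)
    {D : Set (BondConfig (Site d))} {Λ : Finset (Site d)} (hD : IsLowerSet D)
    (hDΛ : DeterminedBy D ↑(edgesIn (zdGraph d) Λ)) : (rcLimit d true p q).real D ≤ P.real D :=
  hP.isBoxLimit_real_le_of_isLowerSet (isBoxLimit_rcLimit true hp hq) hD hDΛ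

/-- **The one-arm events**: `φ⁰_{p,q}(0 ↔ ∂Λ_n) ≤ P(0 ↔ ∂Λ_n)`. [cite: Grimmett2006, Thm. (4.19)(c) eq. (4.21)] -/
theorem rcLimit_false_real_siteToBoundary_le (hP : FKGibbs d p q P) (hp : p ∈ Set.Icc (0 : ℝ) 1) (hq : 1 ≤ q)
    (n : ℕ) : (rcLimit d false p q).real (siteToBoundary d n) ≤ P.real (siteToBoundary d n) :=
  hP.isBoxLimit_real_siteToBoundary_le (isBoxLimit_rcLimit false hp hq)
    ((isBoxLimit_rcLimit false hp hq).ae_subset_edgeSet hp (one_pos.trans_le hq)) n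

/-- **The one-arm events**: `P(0 ↔ ∂Λ_n) ≤ φ¹_{p,q}(0 ↔ ∂Λ_n)`. [cite: Grimmett2006, Thm. (4.19)(c) eq. (4.21)] -/
theorem real_siteToBoundary_le_rcLimit_true (hP : FKGibbs d p q P) (hp : p ∈ Set.Icc (0 : ℝ) 1) (hq : 1 ≤ q)
    (n : ℕ) : P.real (siteToBoundary d n) ≤ (rcLimit d true p q).real (siteToBoundary d n) :=
  hP.real_siteToBoundary_le_isBoxLimit (isBoxLimit_rcLimit true hp hq)
    ((isBoxLimit_rcLimit true hp hq).ae_subset_edgeSet hp (one_pos.trans_le hq)) n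

/-! ### Uniqueness of the class when `φ⁰_{p,q} = φ¹_{p,q}` (Grimmett 2006, (4.36)) -/

/-- **(4.36), "⇐"**: if the free and wired infinite-volume measures coincide, `φ⁰_{p,q} = φ¹_{p,q}`, then every
probability measure satisfying the free/wired sandwich equals `φ⁰_{p,q}`. [cite: Grimmett2006, Thm. (4.34) eq. (4.36)] -/
theorem eq_rcLimit_of_rcLimit_false_eq_true (hP : FKGibbs d p q P) (hp : p ∈ Set.Icc (0 : ℝ) 1) (hq : 1 ≤ q)
    (h : rcLimit d false p q = rcLimit d true p q) : P = rcLimit d false p q :=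
  hP.eq_of_isBoxLimit (isBoxLimit_rcLimit false hp hq) (isBoxLimit_rcLimit true hp hq) h
    ((isBoxLimit_rcLimit false hp hq).ae_subset_edgeSet hp (one_pos.trans_le hq))

/-- Hence, when `φ⁰_{p,q} = φ¹_{p,q}`, the sandwich class has exactly one element: any two of its members
coincide. [cite: Grimmett2006, Thm. (4.34) eq. (4.36)] -/
theorem eq_of_rcLimit_false_eq_true (hP : FKGibbs d p q P) (hP' : FKGibbs d p q P')
    (hp : p ∈ Set.Icc (0 : ℝ) 1) (hq : 1 ≤ q) (h : rcLimit d false p q = rcLimit d true p q) : P = P' := by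
  rw [hP.eq_rcLimit_of_rcLimit_false_eq_true hp hq h, hP'.eq_rcLimit_of_rcLimit_false_eq_true hp hq h]

end FKGibbs

end Summit.CriticalPhenomena.PercolationContinuityZ3.Theorems.FK

end
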